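import Summits.ResolutionOfSingularities.ResolutionOfSingularities.Theses.Valuative
import Summits.ResolutionOfSingularities.ResolutionOfSingularities.Theorems.ValuativePatchingRelEmbResCodimTwo
import Literature.AlgebraicGeometry.Resolution.SandwichedWeakPatching
import Literature.AlgebraicGeometry.Resolution.ZariskiPatchingProperModels
import Literature.AlgebraicGeometry.Resolution.QuasiExcellentSchemes
import Literature.AlgebraicGeometry.Morphisms.NagataCompactificationProofs
import Mathlib

/-!
# crux-triage r2/k3 probe — crux `PatchingRel` (stmt-ResolutionOfSingularities-0642)

1. the crux elaborates (one sorry);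
2. card `bad-stratum-induction`: the collapse theorems of the tree (p143430) re-#checked;
3. card `closed-point-fibre-freedom`: the atom `FibreFreeRegular` re-elaborated verbatim and the
   triager's LU-FREE factorisation target (F1) typed:
   `CossartPiltant2019General → FibreFreeRegular p 4 → SandwichedWeakResolutionUpTo p 4`
   (SANDʷ = the dead line's weak atom, Disproof §14; Nagata is a theorem of the tree).
-/

set_option linter.unusedVariables false

noncomputable section

open CategoryTheory AlgebraicGeometry
open Literature.AlgebraicGeometry.Resolution

namespace CruxTriageR2K3

/-- (1) the crux, by name. -/
theorem probe : Summit.ResolutionOfSingularities.ResolutionOfSingularities.Theses.Valuative.PatchingRel := by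
  sorry

/-! (2) card C: the line built from it is already collapsed in the tree. -/
#check @Summit.ResolutionOfSingularities.ResolutionOfSingularities.Theorems.badStratumPatching_holds
#check @Summit.ResolutionOfSingularities.ResolutionOfSingularities.Theorems.patchingRel_of_embResCodimTwo
#check @Summit.ResolutionOfSingularities.ResolutionOfSingularities.Theorems.resolutionOfSingularities_of_embResCodimTwo

/-! (3) card A. -/

/-- CARD A ATOM, verbatim from `Cruxes/PatchingRel/Round2Ideator4Sketch.lean`. -/
def FibreFreeRegular (p n : ℕ) : Prop :=
  ∀ (k : Type) [Field k] [CharP k p] (S : Type) [CommRing S] [IsRegularLocalRing S] [Algebra k S]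
    [Algebra.EssFiniteType k S], ringKrullDim S ≤ n →
    ∀ (T : Scheme.{0}) (f : T ⟶ Spec (.of S)), IsIntegral T → IsProper f → IsBirational f →
    (∀ t : T, f.base t ≠ IsLocalRing.closedPoint S → IsRegularLocalRing (T.presheaf.stalk t)) →
    ∃ (T' : Scheme.{0}) (π : T' ⟶ T), IsResolution π ∧
      ∃ U : T.Opens, (∀ t : T, t ∈ U ↔ f.base t ≠ IsLocalRing.closedPoint S) ∧ IsIso (π ∣_ U)

/-- Lower STRONG input over arbitrary local bases (verbatim). -/
def LocalFibreRes (p c : ℕ) : Prop :=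
  ∀ (k : Type) [Field k] [CharP k p] (S : Type) [CommRing S] [IsLocalRing S] [IsNoetherianRing S]
    [Algebra k S] [Algebra.EssFiniteType k S], ringKrullDim S ≤ c →
    ∀ (T : Scheme.{0}) (f : T ⟶ Spec (.of S)), IsIntegral T → IsProper f → IsBirational f →
    (∀ t : T, f.base t ≠ IsLocalRing.closedPoint S → IsRegularLocalRing (T.presheaf.stalk t)) →
    ∃ (T' : Scheme.{0}) (π : T' ⟶ T), IsResolution π ∧
      ∃ U : T.Opens, (∀ t : T, t ∈ U ↔ f.base t ≠ IsLocalRing.closedPoint S) ∧ IsIso (π ∣_ U)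

/-- The dead line's WEAK atom SANDʷ (`SandwichedWeakResolution`, Disproof §14), graded by the
dimension of `X` — the recorded dimension-`n` residue of the crux modulo LU and Nagata
(`sandwichedWeakResolution_iff_twoModelPatching`, `resolutionInChar_of_properTwoModelPatching_of_relLU`). -/
def SandwichedWeakResolutionUpTo (p n : ℕ) : Prop :=
  ∀ (k : Type) [Field k] [CharP k p] (X U : Scheme.{0}) (f : X ⟶ Spec (.of k))
    (g : U ⟶ Spec (.of k)) (V : X.Opens) (η : (V : Scheme.{0}) ⟶ U),
    IsSeparated f → LocallyOfFiniteType f → QuasiCompact f → IsIntegral X →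
    IsSeparated g → LocallyOfFiniteType g → QuasiCompact g → IsIntegral U →
    Scheme.IsRegular U → IsProper η → IsBirational η → η ≫ g = V.ι ≫ f →
    (∀ x : X, x ∉ V → IsRegularLocalRing (X.presheaf.stalk x)) →
    topologicalKrullDim X ≤ n →
      Scheme.HasResolution X

/-- Sanity: the ungraded atom is the conjunction of the graded ones. -/
theorem sandwichedWeakResolution_iff_forall_upTo (p : ℕ) :
    SandwichedWeakResolution.{0} p ↔ ∀ n, SandwichedWeakResolutionUpTo p n := by
  constructor
  · intro h n k _ _ X U f g V η h1 h2 h3 h4 h5 h6 h7 h8 h9 h10 h11 h12 h13 _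
    exact h k X U f g V η h1 h2 h3 h4 h5 h6 h7 h8 h9 h10 h11 h12 h13
  · intro h k _ _ X U f g V η h1 h2 h3 h4 h5 h6 h7 h8 h9 h10 h11 h12 h13
    haveI : QuasiCompact f := h3
    haveI : LocallyOfFiniteType f := h2
    haveI : CompactSpace X := QuasiCompact.compactSpace_of_compactSpace f
    obtain ⟨d, hd⟩ := exists_topologicalKrullDim_le_of_locallyOfFiniteType f
    exact h d k X U f g V η h1 h2 h3 h4 h5 h6 h7 h8 h9 h10 h11 h12 h13 hd

/-- **(F1) — the triager's LU-FREE reading of card A's dimension-4 slice** (typed target, NOT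
proved here; the paper proof is in TRIAGE-r2-3.md §A: run the card's own Claim B at CLOSED bad
points of the single regular base `U` — the fibre of `V → U` over a closed point is proper over
`k(ζ)`, hence closed in the separated `X`, so the glued modification has no hole — and
Cossart–Piltant 2019 (iso over `Reg`) at non-closed bad points, whose holes stay inside
`Sing X ⊆ V`; Nagata is `NagataCompactification_holds`). Composed with the tree's
`sandwichedWeakResolution_iff_twoModelPatching` + `resolutionInChar_of_properTwoModelPatching_of_relLU`
(dimension-preserving: all models of one function field) it gives the card's `res_dim_le_four`
with LU consumed exactly once, by the EXISTING patching theorem (Disproof §13 N11). -/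
def F1 : Prop :=
  CossartPiltant2019General.{0} → ∀ p : ℕ, FibreFreeRegular p 4 → SandwichedWeakResolutionUpTo p 4

/-- The all-dimensional composition of card A is degenerate: its second binder is Temkin's local
criterion in fibre form; in particular it contains the regular-base atom outright. -/
theorem fibreFreeRegular_of_localFibreRes {p n : ℕ} (h : LocalFibreRes p n) :
    FibreFreeRegular p n := by
  intro k _ _ S _ _ _ _ hdim T f hT hf hbir hreg
  exact h k S hdim T f hT hf hbir hreg

#check @CossartPiltant2019General
#check @Literature.AlgebraicGeometry.Morphisms.NagataCompactification_holds
#check @sandwichedWeakResolution_iff_twoModelPatching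
#check @resolutionInChar_of_properTwoModelPatching_of_relLU

end CruxTriageR2K3

end
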